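import Summits.Langlands.Langlands.Theses.EisensteinGelfandKirillov
import Summits.Langlands.Langlands.Theorems.ReducibleOrdinaryProModular.Negative.LevelAndRamification

/-!
# Disproof work file for `ProModularOfGKBound` (crux `stmt-Langlands-18273`, route
`EisensteinGelfandKirillov`) — cdisprove cycle 1 (refuter-cdisprove-stmt-Langlands-18273-0)

VERDICT OF THIS CYCLE: **no kill; the crux resists every cheap attack**, for structural reasons
recorded below as checked lemmas.  Index of findings:

* `proModularOfGKBound_iff`, `not_proModularOfGKBound_iff` — ANATOMY: the crux is literally
  `EisensteinGKBound → ProModularity`; hence `¬ crux ↔ (door ∧ ¬ pro-modularity)`.  Any refutation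
  must PROVE the door (crux `stmt-Langlands-18272`, rank 2, open, no proof in print at Eisenstein
  `𝔪`) and exhibit a non-pro-modular `ρ` in the sector.  Neither half is available: see below.
* `proModularOfGKBound_of_not_door` — VACUITY WARNING for planners: if kill criterion (K1) fires
  (the door is refuted by a Brandt-module count), THIS item becomes trivially PROVABLE (it does not
  die with the route).  The item carries content only while the door is alive.
* `proModularity_rat` — the `F = ℚ` slice of the conclusion.  Informally this slice is KNOWN:
  [Pan2022] (arXiv:1901.07166) §5–§7 prove that every irreducible odd a.e.-unramified
  `ρ : Γ_ℚ → GL₂(ℚ̄_p)`, `p ≥ 5` (and `p = 3` off `χ̄₁/χ̄₂|_{G_{ℚ_p}} = ω^{±1}`), with `ρ̄^{ss} = χ̄₁ ⊕ χ̄₂`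
  lies on a pro-modular component of `Spec R^{ps}` (Thm 7.1.1 and its proof, §7.2–7.4, with the
  ordinary loci of §5–6); so a counterexample needs `F ≠ ℚ`.  CAVEAT (over-claim, not refutable
  here): even for `F` abelian with `p` split, every printed pro-modularity theorem in the residually
  reducible case ([Pan2022] Thm 7.1.1 (2nd bullet), [Zhang2024] = arXiv:2411.18661 Thm 1.0.2 (3),
  arXiv:2512.21249) assumes that `χ̄₁/χ̄₂` EXTENDS TO `G_ℚ` (the Skinner–Wiles seed: [SkinnerWiles1999]
  needs the splitting field of `χ̄₁/χ̄₂` abelian over `ℚ`, via Washington's theorem).  The crux has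
  no such hypothesis, so it also claims the OPEN ordinary/Eisenstein cases over non-abelian `F` or
  with `χ̄₁/χ̄₂` not from `ℚ` — cases the route's mechanism (a GK bound replacing `p`-adic local
  Langlands at `v ∣ p`) does not touch.  Recorded for the planner as a possible MIS-SCOPING, not as a
  refutation (no counterexample is known or expected: the conclusion is implied by Fontaine–Mazur-type
  expectations for every `ρ` of the sector).
* REUSED INTERFACE LEMMAS (already LANDED under `Theorems/…/Negative/` by the disprovers of the
  sibling route `SkinnerWilesDefectOne`, same conclusion shape `∃ 𝒰, 𝒰.IsPadicallyAutomorphic ρ` —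
  provers and ideators should import them, not re-prove them):
  `ReducibleOrdinaryProModular.Negative.{isPadicallyAutomorphic_iff, heckeFrobPoly_two,
  bad_of_not_isUnramifiedAt, ae_isUnramifiedAt_of_isPadicallyAutomorphic,
  not_isPadicallyAutomorphic_full, exists_isPadicallyAutomorphic_bad_eq}` (level / ramification:
  WLOG `bad ⊇` ramification ∪ `{v ∣ p}`, the full level never works for ramified `ρ`),
  `ProModularOrdinaryClassical.Negative.norm_apply_le_one_of_continuous` (continuous `ℚ̄_p`-points of
  `𝕋(𝒰)` are `ℤ̄_p`-valued — no "unbounded junk point"),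
  `EisensteinProModularSeed.Negative.{trace_det_frob_of_isAssociated, eisenstein_congruence_of_seed_conclusion}`
  (trace/determinant read off `heckeFrobPoly`, Eisenstein congruence of the point).
* The conclusion IMPLIES the hypothesis "a.e. unramified"
  (`ae_isUnramifiedAt_of_isPadicallyAutomorphic`, imported).  Hence
  `proModularityWithoutAEUnramified_of` / `not_proModularityWithoutAEUnramified_of`:
  dropping that hypothesis is harmless EXACTLY when the sector contains no infinitely ramified `ρ`;
  such `ρ` exist for absolutely irreducible `ρ̄` over `ℚ` ([Ramakrishna2000], Ann. of Math. 151,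
  "Infinitely ramified Galois representations"); for reducible `ρ̄` this is not in print.  So the
  hypothesis is load-bearing only through an (expected) infinitely ramified member of the sector —
  a NEGATIVE LEMMA MODULO `InfinitelyRamifiedSectorRep` (stated below), not a refutation.
* LOAD-BEARING TABLE (docstrings of `ProModularityWithoutOdd`, `…WithoutIrreducible`,
  `…WithoutDistinguished`): expected status of each hypothesis-dropped variant with the witness
  family; none is decidable inside the tree (no Galois representation of a number field with
  controlled ramification AND a proof of non-occurrence in completed cohomology is constructible —
  the tree has no `ρ ↦` Hecke-eigenclass dictionary in either direction).
* JUNK AUDIT of the conclusion's interface (no Lean content needed, recorded here for provers):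
  `𝕋(K^p) = TameLevel.bigHeckeSubring` is a closed subring of `∏_{(r,s,i)} End(H^i(X_{U_r}, ℤ/p^s))`
  containing `1 ≠ 0` (the `s ≥ 1, i = 0` factors are `End` of `H⁰ ∋` constants), the `T_{v,i}` are
  genuine transposed double-coset operators (`heckeAlgebra.doubleCosetOperator`, an indicator in the
  commutant — no `finsum`-over-infinite-support junk: `IsHeckeTriple` is supplied by
  `isHeckeTriple_tower`), `heckeFrobPoly 2 q a = X² − a₁X + q·a₂` matches `H⁰`-Eisenstein classes
  `φ∘det ↦ φ ⊕ φε` (arithmetic Frobenius), `PadicAlgCl p` carries Mathlib's spectral-norm topology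
  (so `Continuous x` is the intended `p`-adic continuity, and `x(p^N) → 0` is consistent with
  `p^N·1 → 0` in the product topology).  No junk model makes the conclusion trivially true or
  trivially false; `TameLevel.full 2 F p` witnesses `Nonempty (TameLevel 2 F p)`.
* PRE-TARGETS: ideator 1's `HeckeDimOfGKBound` (card `hecke-fibre-capture`) is FALSE AS TYPED
  for `[F:ℚ] ≥ 2` — the tree's cohomological `𝕋_𝔪` has an Eisenstein (boundary) component of Krull
  dimension `3 + 2δ_F < 1 + 2[F:ℚ]` (details and fix in the `Targets` section); of ideator 2's three
  sorried first lemmas (`SketchIdeator2.lean`) two PASS (true, provable linear algebra), one is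
  MISSTATED — `reducibleLocus_cutOut` (card `krull-seed`) leaves the
  cyclotomic character `ω` unbound, so its genericity clause is vacuous and the lemma as typed is
  false at `ρ̄_v = χ₁ ⊗ (1 ∗; 0 ω)` (`f+1` equations needed, [Pan2022] p.69 L83 / Cor 7.4.5); see the
  `Targets` section at the end for the computation, the fix, and the consequence (the crux's
  sector CONTAINS that corner).
* NOT ATTEMPTED (anti-leakage / cost): the Brandt-module count for the DOOR (it is crux
  `stmt-Langlands-18272`'s cheapest falsifier, and a door failure only makes this item vacuous —
  see `proModularOfGKBound_of_not_door`).

* `proModularOfGKBound_iff_proModularity_of_door` — BRIDGE to the sibling disprover's finding on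
  the DOOR (`Summits/Langlands/Langlands/Cruxes/EisensteinGKBound/Disproof.lean`,
  `eisensteinGKBoundNondeg_holds`, sorry-free): the door AS TYPED is a theorem up to a Chebotarev
  non-degeneracy (LEVEL COLLAPSE: its Eisenstein condition ranges over Hecke elements with
  unconstrained `p`-component, forcing level `U 0`), hence carries NO Gelfand–Kirillov content.
  Consequently THIS crux, as typed, is `door → Q` with a (morally) provable door: it IS the bare
  unconditional pro-modularity statement `ProModularity` (the lemma records `door ⊢ crux ↔ Q`; the
  sibling module is a crux workfile, not an importable library module, so the door is taken as a
  hypothesis here rather than imported).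
* LITERATURE MAP for `Q = ProModularity` (why no counterexample and no proof are in reach; page hits
  from the materialised texts): [SkinnerWiles1999] (IHES 89) Thm A p.74: `F` totally real ABELIAN,
  splitting field of `χ₁/χ₂` abelian over `ℚ`, `(χ₁/χ₂)(c) = −1`, `(χ₁/χ₂)|_{D_v} ≠ 1`, ORDINARY,
  `det ρ = ψε^{k−1}`; p.75: "A similar result [Washington] for any totally real field would yield the
  same theorem but with the omission of the hypotheses that F and F(χ₁/χ₂) be abelian" (Thm B:
  general `F` under Hypothesis H — open).  [Pan2022] Thm 7.1.1 (p.69 of arXiv:1901.07166): `F`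
  abelian, `p` split completely, `χ̄₁/χ̄₂` extends to `G_ℚ`, `ρ|_{G_{F_v}}` irreducible de Rham regular;
  its proof (§7.2–7.4 + §5–6) yields pro-modularity of the component `C ∋ 𝔭_ρ`.  [Zhang2024]
  (arXiv:2411.18661) Thm 1.0.2: `F` abelian of even degree, `p` split, `χ̄` extends to `G_ℚ`,
  `χ̄|_{G_{F_v}} ≠ 1, ω^{±1}`.  [GeeNewton2020] §4.3: codimension `j_{k⟦K₀⟧}(fibre) ≥ dim B` ⇒ big
  `R = 𝕋`, lci, flat — at a NON-Eisenstein `𝔪` under Taylor–Wiles hypotheses.  Hence `Q` strictly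
  contains three independent open extensions: (α) `F_v ≠ ℚ_p` (the route's target), (β) `F`
  non-abelian / `χ̄₁/χ̄₂` not from `G_ℚ` (the SEED: SW Thm B territory, conditional since 1999),
  (γ) Gee–Newton flatness at a one-dimensional Eisenstein prime (no statement in print).  The
  route's mechanism addresses (α) and (γ) only; (β) is inherited by every seed stub.

Nothing in this file is a refutation; nothing here is proposed under `Theorems/`.  Provers: the
only cheap facts are the anatomy lemmas; the mathematics of the engine is Pan's patching at a nice
prime with the door in place of Paškūnas — see the route rationale.
-/

set_option linter.dupNamespace false -- `Summit.Langlands.Langlands` is the mandated namespace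

namespace Summit.Langlands.Langlands.Cruxes.ProModularOfGKBound.Disproof

open Summit.Langlands.Langlands.Theses.EisensteinGelfandKirillov
open scoped NumberField
open Filter IsDedekindDomain
open Literature.NumberTheory.GaloisRepresentations Literature.NumberTheory.Automorphic

/-! ## Anatomy of the crux -/

/-- The CONSEQUENT of the engine, verbatim (the crux is `EisensteinGKBound → ProModularity`):
pro-modularity of every irreducible, totally odd, a.e. unramified, residually upper-triangular,
`p`-distinguished `ρ : Γ_F → GL₂(ℚ̄_p)` over a totally real `F`, `p ≥ 5` unramified in `F`.
[folklore] -/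
def ProModularity : Prop :=
  ∀ (F : Type) [Field F] [NumberField F], NumberField.IsTotallyReal F → ∀ (p : ℕ) [Fact p.Prime], 5 ≤ p → ¬ ((p : ℤ) ∣ NumberField.discr F) → ∀ (O : ValuationSubring (PadicAlgCl p)), O = (Valued.v : Valuation (PadicAlgCl p) NNReal).valuationSubring → ∀ (ρ : Literature.NumberTheory.GaloisRepresentations.FramedGaloisRep F (PadicAlgCl p) 2) (ρ₀ : Field.absoluteGaloisGroup F →* Matrix.GeneralLinearGroup (Fin 2) O), ρ.toGaloisRep.IsIrreducible → ρ.IsOdd → (∀ᶠ v in cofinite, ρ.IsUnramifiedAt v) → ρ.HasUpperTriangularIntegralModel ρ₀ → (∀ (v : IsDedekindDomain.HeightOneSpectrum (NumberField.RingOfIntegers F)), ((p : ℕ) : NumberField.RingOfIntegers F) ∈ v.asIdeal → Literature.NumberTheory.GaloisRepresentations.IsPDistinguishedAt ρ₀ v) → ∃ 𝒰 : Literature.NumberTheory.Automorphic.BigHeckeGLn.TameLevel 2 F p, 𝒰.IsPadicallyAutomorphic ρ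

/-- The crux IS the implication "door ⇒ pro-modularity" (definitional unfolding). [folklore] -/
theorem proModularOfGKBound_iff : ProModularOfGKBound ↔ (EisensteinGKBound → ProModularity) :=
  Iff.rfl

/-- Consequently a refutation of the crux is EXACTLY a proof of the door together with a
non-pro-modular member of the sector. [folklore] -/
theorem not_proModularOfGKBound_iff :
    ¬ ProModularOfGKBound ↔ (EisensteinGKBound ∧ ¬ ProModularity) := by
  rw [proModularOfGKBound_iff, Classical.not_imp]

/-- VACUITY: a refuted door (route kill criterion K1) PROVES this item. [folklore] -/
theorem proModularOfGKBound_of_not_door (h : ¬ EisensteinGKBound) : ProModularOfGKBound :=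
  fun hd => absurd hd h

/-- Monotonicity: the unconditional pro-modularity statement implies the crux. [folklore] -/
theorem proModularOfGKBound_of_proModularity (h : ProModularity) : ProModularOfGKBound :=
  fun _ => h

/-- BRIDGE (door ⊢ crux ↔ Q).  The sibling work file
`Cruxes/EisensteinGKBound/Disproof.lean` proves the door as typed in its non-degenerate case
(`eisensteinGKBoundNondeg_holds`, level collapse) and reduces the degenerate corner to Chebotarev;
granted the door, this crux is EXACTLY unconditional pro-modularity — the typed door feeds the
engine nothing.  (Hypothesis instead of import: crux work files are not library modules.)
[folklore] -/
theorem proModularOfGKBound_iff_proModularity_of_door (hd : EisensteinGKBound) :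
    ProModularOfGKBound ↔ ProModularity :=
  ⟨fun h => h hd, fun h _ => h⟩

/-! ## The known slice `F = ℚ` -/

/-- The `F = ℚ` slice of the conclusion (informally [Pan2022] §5–7; `discr ℚ = 1`, so the
discriminant clause is automatic).  A counterexample to the crux must live over `F ≠ ℚ`. -/
def ProModularityRat : Prop :=
  ∀ (p : ℕ) [Fact p.Prime], 5 ≤ p → ∀ (O : ValuationSubring (PadicAlgCl p)), O = (Valued.v : Valuation (PadicAlgCl p) NNReal).valuationSubring → ∀ (ρ : Literature.NumberTheory.GaloisRepresentations.FramedGaloisRep ℚ (PadicAlgCl p) 2) (ρ₀ : Field.absoluteGaloisGroup ℚ →* Matrix.GeneralLinearGroup (Fin 2) O), ρ.toGaloisRep.IsIrreducible → ρ.IsOdd → (∀ᶠ v in cofinite, ρ.IsUnramifiedAt v) → ρ.HasUpperTriangularIntegralModel ρ₀ → (∀ (v : IsDedekindDomain.HeightOneSpectrum (NumberField.RingOfIntegers ℚ)), ((p : ℕ) : NumberField.RingOfIntegers ℚ) ∈ v.asIdeal → Literature.NumberTheory.GaloisRepresentations.IsPDistinguishedAt ρ₀ v) → ∃ 𝒰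 : Literature.NumberTheory.Automorphic.BigHeckeGLn.TameLevel 2 ℚ p, 𝒰.IsPadicallyAutomorphic ρ

/-- `ProModularity` specialises to `F = ℚ` (`IsTotallyReal ℚ`, `discr ℚ = 1`). [folklore] -/
theorem proModularity_rat (h : ProModularity) : ProModularityRat := by
  intro p _ hp O hO ρ ρ₀ hirr hodd hur hup hdist
  refine h ℚ inferInstance p hp ?_ O hO ρ ρ₀ hirr hodd hur hup hdist
  rw [Rat.numberField_discr]
  intro hdvd
  have h1 : ((p : ℤ)).natAbs ∣ (1 : ℤ).natAbs := Int.natAbs_dvd_natAbs.2 hdvd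
  simp only [Int.natAbs_natCast, Int.natAbs_one, Nat.dvd_one] at h1
  omega

/-! ## The conclusion implies the "a.e. unramified" hypothesis -/

/-! The conclusion implies the hypothesis "a.e. unramified": this is the LANDED lemma
`Summit.Langlands.Langlands.Theorems.ReducibleOrdinaryProModular.Negative.ae_isUnramifiedAt_of_isPadicallyAutomorphic`
(imported; not re-proved here). -/

/-- The conclusion with the a.e.-unramified hypothesis DROPPED (a natural strengthening). -/
def ProModularityWithoutAEUnramified : Prop :=
  ∀ (F : Type) [Field F] [NumberField F], NumberField.IsTotallyReal F → ∀ (p : ℕ) [Fact p.Prime], 5 ≤ p → ¬ ((p : ℤ) ∣ NumberField.discr F) → ∀ (O : ValuationSubring (PadicAlgCl p)), O = (Valued.v : Valuation (PadicAlgCl p) NNReal).valuationSubring → ∀ (ρ : Literature.NumberTheory.GaloisRepresentations.FramedGaloisRep F (PadicAlgCl p) 2) (ρ₀ : Field.absoluteGaloisGroup F →* Matrix.GeneralLinearGroup (Fin 2) O), ρ.toGaloisRep.IsIrreducible → ρ.IsOdd → ρ.HasUpperTriangularIntegralModel ρ₀ → (∀ (v : IsDedekindDomain.HeightOneSpectrum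 (NumberField.RingOfIntegers F)), ((p : ℕ) : NumberField.RingOfIntegers F) ∈ v.asIdeal → Literature.NumberTheory.GaloisRepresentations.IsPDistinguishedAt ρ₀ v) → ∃ 𝒰 : Literature.NumberTheory.Automorphic.BigHeckeGLn.TameLevel 2 F p, 𝒰.IsPadicallyAutomorphic ρ

/-- `H` for the negative lemma: the sector contains an INFINITELY RAMIFIED member (an irreducible,
totally odd, residually upper-triangular, `p`-distinguished `ρ : Γ_F → GL₂(ℚ̄_p)`, `F` totally real,
`p ≥ 5` unramified in `F`, ramified at infinitely many places).  Expected TRUE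
([Ramakrishna2000] constructs infinitely ramified irreducible odd `ρ : Γ_ℚ → GL₂(ℤ_p)` for absolutely
irreducible `ρ̄`; the residually reducible analogue is not in print) but NOT constructible in the
tree (no Galois representation of a number field with prescribed ramification is). [folklore] -/
def InfinitelyRamifiedSectorRep : Prop :=
  ∃ (F : Type) (_ : Field F) (_ : NumberField F), NumberField.IsTotallyReal F ∧ ∃ (p : ℕ) (_ : Fact p.Prime), 5 ≤ p ∧ ¬ ((p : ℤ) ∣ NumberField.discr F) ∧ ∃ (O : ValuationSubring (PadicAlgCl p)), O = (Valued.v : Valuation (PadicAlgCl p) NNReal).valuationSubring ∧ ∃ (ρ : Literature.NumberTheory.GaloisRepresentations.FramedGaloisRep F (PadicAlgCl p) 2) (ρ₀ : Field.absoluteGaloisGroup F →* Matrix.GeneralLinearGroup (Fin 2) O), ρ.toGaloisRep.IsIrreducible ∧ ρ.IsOdd ∧ ρ.HasUpperTriangularIntegralModel ρ₀ ∧ (∀ (v : IsDedekindDomain.HeightOneSpectrum (NumberField.RingOfIntegers F)), ((p : ℕ) : NumberField.RingOfIntegers F) ∈ v.asIdeal → Literature.NumberTheory.GaloisRepresentations.IsPDistinguishedAt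 ρ₀ v) ∧ ¬ (∀ᶠ v in cofinite, ρ.IsUnramifiedAt v)

/-- The strengthening trivially implies the conclusion. [folklore] -/
theorem proModularity_of_without_aeUnramified (h : ProModularityWithoutAEUnramified) :
    ProModularity :=
  fun F _ _ hF p _ hp hdisc O hO ρ ρ₀ hirr hodd _ hup hdist =>
    h F hF p hp hdisc O hO ρ ρ₀ hirr hodd hup hdist

/-- NEGATIVE LEMMA MODULO `InfinitelyRamifiedSectorRep`: an infinitely ramified member of the
sector kills the strengthening (association is unramified off the finite `𝒰.bad`).  This is the
precise sense in which the a.e.-unramified hypothesis of the crux is load-bearing. [folklore] -/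
theorem not_proModularityWithoutAEUnramified_of (H : InfinitelyRamifiedSectorRep) :
    ¬ ProModularityWithoutAEUnramified := by
  intro h
  obtain ⟨F, _, _, hF, p, _, hp, hdisc, O, hO, ρ, ρ₀, hirr, hodd, hup, hdist, hram⟩ := H
  obtain ⟨𝒰, h𝒰⟩ := h F hF p hp hdisc O hO ρ ρ₀ hirr hodd hup hdist
  exact hram
    (Summit.Langlands.Langlands.Theorems.ReducibleOrdinaryProModular.Negative.ae_isUnramifiedAt_of_isPadicallyAutomorphic
      𝒰 ρ h𝒰)

/-- Conversely, absent infinitely ramified members the hypothesis is decoration. [folklore] -/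
theorem proModularityWithoutAEUnramified_of (h : ProModularity) (hno : ¬ InfinitelyRamifiedSectorRep) :
    ProModularityWithoutAEUnramified := by
  intro F _ _ hF p _ hp hdisc O hO ρ ρ₀ hirr hodd hup hdist
  by_cases hur : ∀ᶠ v in cofinite, ρ.IsUnramifiedAt v
  · exact h F hF p hp hdisc O hO ρ ρ₀ hirr hodd hur hup hdist
  · exact absurd ⟨F, _, _, hF, p, _, hp, hdisc, O, hO, ρ, ρ₀, hirr, hodd, hup, hdist, hur⟩ hno

/-! ## Load-bearing table for the remaining hypotheses (documentation; nothing provable here)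

For each hypothesis `H` of the conclusion, `ProModularityWithout<H>` below is the conclusion with
`H` dropped.  Status (informal, with the witness family a disproof would need):

* `WithoutOdd` — EXPECTED FALSE.  Witness family: totally EVEN irreducible `ρ` with reducible
  reduction, e.g. `ρ = Ind_{Γ_K}^{Γ_F} ψ` for a totally real quadratic `K/F` and a `p`-adic character
  `ψ` of `Γ_K` of the same sign at the two places over each real place (`det ρ(c) = +1`), reducible
  mod `p` when `ψ̄ = ψ̄^σ`.  Non-occurrence: every eigensystem in `H^•(X_U, ℤ/p^s)` for `GL₂/F` is
  totally odd (`H⁰`: `φ ⊕ φε`; cuspidal and Eisenstein classes: odd), and oddness is closed under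
  `p`-adic limits of pseudo-characters.  Neither half is formalisable in the tree today.
* `WithoutIrreducible` — EXPECTED TRUE for the CONCLUSION, at least over `F = ℚ`: a reducible
  totally odd a.e.-unramified `ρ = ψ₁ ⊕ ψ₂` is an Eisenstein point (`H⁰` classes `φ∘det` give
  `φ ⊕ φε`; the weight-2 Eisenstein classes `E₂^{ψ,φ}`, `ψφ` even, in `H¹` of the `p^∞`-tower give
  `ψ ⊕ φε`, and `ℤ/p^s`-interpolation reaches every totally odd pair of continuous `p`-adic
  characters).  The gen-1 crux-attack note (`CruxAttackGen1.md`, mutation row) says "false in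
  general" without a witness; for ODD pairs we disagree, for general `F` we make no claim (Harder's
  Eisenstein cohomology, parity at each real place).  Either way irreducibility is load-bearing for
  the intended PROOF (Pan's dimension count `h¹ − h² = 2[F:ℚ]` uses `h⁰(ad⁰ρ) = 0`, [Pan2022]
  Lemma 7.1.3), which is what matters to provers.
* `WithoutDistinguished` — EXPECTED TRUE over `F = ℚ` ([Pan2022] §6–7 treat
  `χ̄₁/χ̄₂|_{G_{ℚ_p}} = 1` and `= ω^{±1}` for `p ≥ 5`); over general `F` it is the hypothesis of the
  Skinner–Wiles/Zhang ordinary SEED ([SkinnerWiles1999] Thm (ii) `χ|_{D_v} ≠ 1`; arXiv:2411.18661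
  Thm 1.0.2 (4) `χ̄|_{G_{F_v}} ≠ 1, ω^{±1}`).  Load-bearing for the route's proof, plausibly not for
  truth.
* `5 ≤ p` / `p ∤ disc F` — scoping, not truth: the conclusion is expected for all `p` (Pan's
  `p = 3` caveat concerns the METHOD).  Dropping them cannot be refuted here either.
-/

/-- Conclusion with total oddness dropped — EXPECTED FALSE (even `ρ` do not occur in completed
cohomology of `GL₂` over a totally real field); see the table above. -/
def ProModularityWithoutOdd : Prop :=
  ∀ (F : Type) [Field F] [NumberField F], NumberField.IsTotallyReal F → ∀ (p : ℕ) [Fact p.Prime], 5 ≤ p → ¬ ((p : ℤ) ∣ NumberField.discr F) → ∀ (O : ValuationSubring (PadicAlgCl p)), O = (Valued.v : Valuation (PadicAlgCl p) NNReal).valuationSubring → ∀ (ρ : Literature.NumberTheory.GaloisRepresentations.FramedGaloisRep F (PadicAlgCl p) 2) (ρ₀ : Field.absoluteGaloisGroup F →* Matrix.GeneralLinearGroup (Fin 2) O), ρ.toGaloisRep.IsIrreducible → (∀ᶠ v in cofinite, ρ.IsUnramifiedAt v) → ρ.HasUpperTriangularIntegralModel ρ₀ → (∀ (v : IsDedekindDomain.HeightOneSpectrum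 (NumberField.RingOfIntegers F)), ((p : ℕ) : NumberField.RingOfIntegers F) ∈ v.asIdeal → Literature.NumberTheory.GaloisRepresentations.IsPDistinguishedAt ρ₀ v) → ∃ 𝒰 : Literature.NumberTheory.Automorphic.BigHeckeGLn.TameLevel 2 F p, 𝒰.IsPadicallyAutomorphic ρ

/-- Conclusion with irreducibility dropped — EXPECTED TRUE (Eisenstein points); see the table. -/
def ProModularityWithoutIrreducible : Prop :=
  ∀ (F : Type) [Field F] [NumberField F], NumberField.IsTotallyReal F → ∀ (p : ℕ) [Fact p.Prime], 5 ≤ p → ¬ ((p : ℤ) ∣ NumberField.discr F) → ∀ (O : ValuationSubring (PadicAlgCl p)), O = (Valued.v : Valuation (PadicAlgCl p) NNReal).valuationSubring → ∀ (ρ : Literature.NumberTheory.GaloisRepresentations.FramedGaloisRep F (PadicAlgCl p) 2) (ρ₀ : Field.absoluteGaloisGroup F →* Matrix.GeneralLinearGroup (Fin 2) O), ρ.IsOdd → (∀ᶠ v in cofinite, ρ.IsUnramifiedAt v) → ρ.HasUpperTriangularIntegralModel ρ₀ → (∀ (v : IsDedekindDomain.HeightOneSpectrum (NumberField.RingOfIntegers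 F)), ((p : ℕ) : NumberField.RingOfIntegers F) ∈ v.asIdeal → Literature.NumberTheory.GaloisRepresentations.IsPDistinguishedAt ρ₀ v) → ∃ 𝒰 : Literature.NumberTheory.Automorphic.BigHeckeGLn.TameLevel 2 F p, 𝒰.IsPadicallyAutomorphic ρ

/-- Conclusion with `p`-distinguishedness dropped — EXPECTED TRUE (known for `F = ℚ`, [Pan2022]);
load-bearing only for the route's Skinner–Wiles seed; see the table. -/
def ProModularityWithoutDistinguished : Prop :=
  ∀ (F : Type) [Field F] [NumberField F], NumberField.IsTotallyReal F → ∀ (p : ℕ) [Fact p.Prime], 5 ≤ p → ¬ ((p : ℤ) ∣ NumberField.discr F) → ∀ (O : ValuationSubring (PadicAlgCl p)), O = (Valued.v : Valuation (PadicAlgCl p) NNReal).valuationSubring → ∀ (ρ : Literature.NumberTheory.GaloisRepresentations.FramedGaloisRep F (PadicAlgCl p) 2) (ρ₀ : Field.absoluteGaloisGroup F →* Matrix.GeneralLinearGroup (Fin 2) O), ρ.toGaloisRep.IsIrreducible → ρ.IsOdd → (∀ᶠ v in cofinite, ρ.IsUnramifiedAt v) → ρ.HasUpperTriangularIntegralModel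 ρ₀ → ∃ 𝒰 : Literature.NumberTheory.Automorphic.BigHeckeGLn.TameLevel 2 F p, 𝒰.IsPadicallyAutomorphic ρ

/-- Each dropped-hypothesis variant is a STRENGTHENING of the conclusion (sanity: the variants are
typed consistently with `ProModularity`). [folklore] -/
theorem proModularity_of_variants :
    (ProModularityWithoutOdd → ProModularity) ∧ (ProModularityWithoutIrreducible → ProModularity) ∧
      (ProModularityWithoutDistinguished → ProModularity) :=
  ⟨fun h F _ _ hF p _ hp hdisc O hO ρ ρ₀ hirr _ hur hup hdist =>
      h F hF p hp hdisc O hO ρ ρ₀ hirr hur hup hdist,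
    fun h F _ _ hF p _ hp hdisc O hO ρ ρ₀ _ hodd hur hup hdist =>
      h F hF p hp hdisc O hO ρ ρ₀ hodd hur hup hdist,
    fun h F _ _ hF p _ hp hdisc O hO ρ ρ₀ hirr hodd hur hup _ =>
      h F hF p hp hdisc O hO ρ ρ₀ hirr hodd hur hup⟩

/-! ## Targets (lead's stuck stubs)

None registered yet (payload `stuck_stubs = []`; `PICKED.md` drives ideator 1's "Sketch", whose
file is not in the tree).  On re-arm, stubs named `NicePrimeSeed`, `MiracleFlatnessAtNicePrime`,
`HeckeDimOfGKBound`, `CaptureAtRegularPoint` are the natural targets: attack the SEED's scope first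
(non-abelian `F`, `χ̄₁/χ̄₂` not from `G_ℚ`: SW Thm B territory), then any stub fed by the DOOR (it
inherits the level collapse: the typed door bounds nothing at deep level), then the localisation of
[GeeNewton2020] §4.3 miracle flatness at a one-dimensional prime (K2).

## Pre-targets: the three sorried "first lemmas" of `Cruxes/ProModularOfGKBound/SketchIdeator2.lean`
(ideator 2, cards `two-leaf-fern`, `krull-seed`, `gk-additivity`) — cheap attacks run this cycle

* `Sketch.twoLeaf_span` — PASS (true, pure linear algebra): `tangentSpaceWith S L` is
  `H¹_{unr} ⊓ ⨅_v comap (L v)` (GlobalTriangulineSpace L313), so `T_{L ⊓ L'} = T_L ⊓ T_{L'}` and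
  `T_L, T_{L'} ≤ T_⊤`; with `T_L ⊓ T_{L'} = ⊥` and `dim T_L + dim T_{L'} = dim T_⊤ < ∞` the
  dimension formula for `⊔` gives `T_L ⊔ T_{L'} = T_⊤`.  No arithmetic content; provable now.
* `Sketch.finrank_le_finrank_alg_mul_finrank_torsion` — PASS (true): `A` is Artinian local, `V`
  embeds in the injective hull of its socle `W = V[𝔪_A]`, a sum of `dim_κ W` copies of
  `A^∨ = Hom_k(A,k)` (`κ = A/𝔪 ⊇ k`), so `dim_k V ≤ dim_k W · dim_k A / [κ:k] ≤ dim_k A · dim_k W`.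
  Tight at `V = A = k[x]/(xⁿ)`.  Provable now (Matlis duality for finite-dimensional algebras).
* `Sketch.reducibleLocus_cutOut` (card `krull-seed`) — **MISSTATED AS TYPED, FALSE INSTANCE ON
  PAPER.**  The genericity hypothesis `hgen : χ₁ * χ₂⁻¹ ≠ ω ∧ χ₂ * χ₁⁻¹ ≠ ω` binds `ω` as a FREE
  variable ("intended: the mod-`p` cyclotomic character"): instantiating `ω := 1` reduces `hgen` to
  `hdist`, so the lemma as typed asserts the cut-out by `≤ f` equations for EVERY non-split
  `p`-distinguished `ρ̄_v`, including `ρ̄_v = χ₁ ⊗ (1 ∗; 0 ω)` (quotient/sub `= ω`).  There it fails: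
  `h²(G_K, ad ρ̄_v) = dim Hom_G(ρ̄_v, ρ̄_v ⊗ ω) = 1` (the composite `ρ̄_v ↠ χ₁ω ↪ ρ̄_v ⊗ ω`), so
  `R^□ = P/(r)` with `P` smooth on `4f+5` variables and `r ≠ 0` (Böckle–Iyengar–Paškūnas: `R^□` is
  a complete intersection of relative dimension `4f+4`), while the reducible locus is formally
  smooth of relative dimension `3f+4` (`h²(G_K, 𝔟) = dim Hom_G(𝔟, ω) = 0` for NON-split `ρ̄_v`, `p`
  odd: the connecting map `Hom_G(U, ω) → Ext¹(1², ω)` hits the non-zero class of `𝔟`), hence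
  `= P/J` with `J` generated by `f+1` coordinates; `r ∈ J ∩ 𝔪_P² = 𝔪_P J`, so the reducible-locus
  ideal `I = J/(r) ⊂ R^□` has `μ(I) = f + 1 > f`.  Printed corroboration at the pseudo-deformation
  level: [Pan2022] §7.4 (the case `χ̄|_{G_{F_v}} = ω^{±1}`), Lemma 7.4.4 / Cor 7.4.5 (p.72 of
  arXiv:1901.07166): "the kernel of `R^{ps} → R^{ps,ord}` is generated by `2[F:ℚ]` elements"
  (`= f_v + 1 = 2` per split place, via [Paskunas2013] App. B, Cor B.5/B.16) versus `[F:ℚ]` in the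
  generic case (Lemma 7.2.1 = "Corddim", p.69: "the kernel of `R^{ps}_v → R^{ps,ord}_v` is a
  principal ideal", [Paskunas2013] Cor B.20) — and verbatim, p.69 L83: "This is the essential reason
  that we rule out the case `χ̄|_{G_{F_v}} = ω^{±1}` as in this case, the kernel is generated by two
  elements"; p.71 L43: "lemma (Corddim) might not hold in general. Hence we need some careful study
  of `C^{ord}`".  FIX: bind `ω` to the tree's mod-`p` cyclotomic character
  of `Γ_K` (then the lemma is the intended, plausible one).  CONSEQUENCE FOR THE LINE: the crux's
  sector assumes only `p`-distinguishedness, so it CONTAINS the `ω`-corner; there the ordinary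
  locus is cut out by `f_v + 1` equations per place, `dim C^{ord} ≥ 1` only (Pan Cor 7.4.5), and
  Pan reaches the theorem solely through the "good component" chain (Def 7.4.1, Lemma 7.4.2,
  Prop 7.4.3 — proved with `p` split and Paškūnas' explicit rings).  A `krull-seed` line must
  either split the sector (generic / `ω`-corner) or budget the extra equation; as sketched it does
  not reach the corner.  (Advisory: these are ideator sketches, not registered stubs.)
* `Sketch.HeckeDimOfGKBound` (card `hecke-fibre-capture`, ideator 1; read from the card's rendering,
  Ideas/hecke-fibre-capture.md L60–64 — the Sketch file itself is not in the tree) — **FALSE AS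
  TYPED for `[F:ℚ] ≥ 2` (on paper), e.g. the route's showcase `F = ℚ(√5)`.**  (1) Its hypothesis is
  the typed door (junk-true), so it asserts UNCONDITIONALLY: at an Eisenstein maximal ideal `𝔪` of
  the tree's cohomological `𝕋(K^p)` of `GL₂/F`, EVERY minimal prime `P` of `𝕋_𝔪` has
  `1 + 2[F:ℚ] ≤ dim 𝕋_𝔪/P`.  (2) The tree's `𝕋` is built from `H^i(X_{U_r}, ℤ/p^s)` in ALL degrees
  of the non-compact quotients, with free central character: it carries the EISENSTEIN component
  `Z_Eis ∋ 𝔪` — closure of the parallel-weight-2 Eisenstein eigensystems `T_{v,1} ↦ ψ(v) + q_vφ(v)`,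
  `T_{v,2} ↦ ψφ(v)` (Harder; `H⁰` gives `ψ = φ`), i.e. pseudo-characters `ψ ⊕ φε` with `ψ, φ`
  continuous `p`-adic characters of `Gal(F(Np^∞)/F)` (`ℤ_p`-rank `1 + δ_F`), so
  `dim Z_Eis = 3 + 2δ_F`; it is a COMPONENT (the cuspidal Hecke algebra modulo its Eisenstein ideal
  is `Λ/(L_p)` — Mazur–Wiles/Wiles/Ohta — a proper divisor of `Z_Eis`).  For `F` real quadratic
  `δ_F = 0` (Brumer), so `dim Z_Eis = 3 < 5`.  Printed anchor: [Pan2022] p.51 L46, fixed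
  determinant: "the reducible locus has dimension at most `δ_F + 2 ≤ [F:ℚ]`" (free determinant:
  `+ (1 + δ_F)`); Pan's Thm 3.6.1 (p.21, every component `≥ 1 + 2[F:ℚ]`) is for the DEFINITE
  QUATERNION algebra's completed cohomology with fixed central character — no boundary there.  For
  `F = ℚ` the cohomological statement survives only by the coincidence `3 = 1 + 2·1`.  FIX: quantify
  over minimal primes with IRREDUCIBLE generic pseudo-character (all the line uses is `C ∋ 𝔭_ρ`), or
  type it over a definite-quaternionic completed Hecke algebra with fixed central character; note
  that a componentwise JL transfer `D^× ↔ GL₂` of "every component is big" is false exactly because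
  of `Z_Eis`.  Evidence file: `stubs/HeckeDimOfGKBound.md` on the item.
* cards `two-leaf-fern` / `eisenstein-fern`, cheapest falsifier (1) (dimension count at one point,
  `F_v` unramified of degree `f`, `n = 2`, trace-zero adjoint): `dim H¹(G_{F_v}, ad⁰V) = 3f`,
  `dim H¹_{tri,R}(ad⁰) = (3f+1) − (f+1) = 2f` (Nakamura: `dim X_{tri} = dim H¹(ad V) − f`, minus the
  scalar block, all of which is trianguline), `h¹_f(ad⁰V) = f`; two `2f`-planes in a `3f`-space meet
  in `≥ f = h¹_f` dimensions, so counting alone produces NO `f+1` obstruction — PASS; the content of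
  `hcap` is genuine transversality (Chenevier/Nakamura) plus Newton–Thorne, and in the FULL adjoint
  the intersection exceeds `H¹_f` by the non-de-Rham cyclotomic-twist line (run with `ad⁰`, as both
  cards say).  Their real exposure is the SEED (a non-CM classical point on `C ∋ 𝔭_ρ`), i.e. (β).
* (advisory, joint sufficiency) card `gk-additivity`: its lever `δ(M) ≤ dim A + δ(M/𝔪_A M)` turns the
  (intended) door into a RING-level bound `dim 𝕋_𝔪 ≥ 1 + 2d` (`A = 𝕋_𝔪/Ann M`), whereas Pan's
  patching at a nice prime `𝔮` consumes the COMPONENT-level statement ([Pan2022] p.41 L56: "each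
  irreducible component of `𝕋̂_𝔮` has dimension at least `2[F:ℚ]`", from Thm 3.6.1).  A line built
  on this card must bridge ring → component (equidimensionality of the definite-quaternionic `𝕋_𝔪`
  at Eisenstein level is not in print; on the cohomological `GL₂` side it is false, see `Z_Eis`).
-/

end Summit.Langlands.Langlands.Cruxes.ProModularOfGKBound.Disproof
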